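import Summits.QuantumFields.YangMills.Theorems.BalabanUVNodesN11CondLawInFibreChartAtRecord

/-!
# DAG node N11 — THE FIBRE-INTEGRABILITY ROWS OF THE KERNEL-LEVEL SOCKET DISCHARGED FROM GRAPH INTEGRABILITY; def-T's (†) at the record for ALL `s′`, SEPARATED,
# with no fibre-integrability hypothesis

HEADER.  Cell `pub-ymgap`, YM-PLAN Track A (D-0062), seat `pub-ymgap-dag-n08-w2` (g8; WIDTH SEAT 2∕4 on N08 [B10], RE-POINTED to N11's [III] §3-supply residue), route
`BalabanUVNodes`, key K1⁷ `StabilityBAtRecordR13SepCoPH` = stmt-QuantumFields-20542 (helper lane `--supports 20542 --as helper` — jail key; K1⁹ 27364 of record, mis-key rule;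
count-neutral; (B4)-socket bookkeeping).  [I] = [Balaban1987RG1], [III] = [Balaban1988Convergent].  FILE 8 of this seat's kernel-level socket (FILE 1 p611747 · FILE 2 p618553 ·
FILE 5 `…SkewAssembly` p621159 · FILE 6 `…CondLawInFibreChartAtRecord` p624196 · FILE 7 `…TStepInPrivateCoordinateChart` p622706).  Per-density twin for 11a's restricted
carriers: dag-n11-w2 g3's `…N11KernelRTSectionIntegrable` (p622291) — CITED, other road.
WHY.  The real-valued faces of FILES 5–7 DISPLAY a per-`V′` fibre-integrability row (`Integrable (J_in · ρ_{V′} ∘ chart) ((condLaw … ⊗ δ) ⊗ₘ κ_in)`) because Fubini on the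
fibre needs it; for def-T's (†) the integrand `ρ_{V′}(U) = w_k(s′)(U,V′)·χ_k·T(U)` is read on the GRAPH `V′ = Ū`, where def-T ∕ dag-n11-d supply `dU`-integrability of
`U ↦ w_k(s′)(U, Ū)·χ_k·T(U)`.  THIS FILE turns graph integrability into the fibre rows: (§1, generic) under `hchart`, `∫ J·|G(z.1, Ψ z)| d(μ ⊗ₘ κ) = ∫_{window} |G| d(jointLaw)
≤ ∫ |G(Ū,U)| dν` (the chart lands in the window where `J ≠ 0`), so the `V`-sections are `κ_V`-integrable for a.e. `V` (`Measure.integrable_compProd_iff`); (§2, FILE 5's composite)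
the row holds a.e. WHERE THE OUTSIDE DENSITY IS NON-ZERO (`integrable_smul_measure`), hence the skew transport identity for ONE graph-integrable `V`-dependent integrand with no
fibre row (`0 = 0` where the density vanishes); (§3, AT THE RECORD, keyed on FILE 1's `hchart` for the glue-transported composite kernel on ANY window — FILE 6 ★★★ or an
inner-step chart through FILE 3 produce it) the same along `e_α`, and def-T's (†) `tstepOfRecord … s′ V′ = kernelRTOfRecord F N K k sV sV′ (inside chart integral) o` for `dV′`-a.e.
`V′` and ALL `s′` AT ONCE — `SeqOfRecord` (r11's (2.18) index) is FINITE, so `ae_all_iff` makes the null set uniform.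
CONTENTS (0 `def`, 0 `sorry`): §1 `integrable_chart_of_integrable_graph` · ★ `ae_integrable_chart_of_integrable_graph`; §2 ★ `ae_integrable_skew_of_integrable_graph` · ★★
`ae_kernelTransport_skew_eq_chart_of_integrable_graph`; §3 ★ `ae_integrable_glue_of_integrable_graph` · ★★★ `ae_forall_tstepOfRecord_eq_kernelRTOfRecord_glue_of_integrable_graph`.
HONEST FRAMING.  Helper lane (aside key); count-neutral; pure measure theory (Tonelli, `ae_withDensity_iff`, `Measure.integrable_compProd_iff`, `integrable_smul_measure`,
`MeasurableEmbedding.ae_map_iff`, `ae_all_iff`) over FILES 1∕5∕6; NO chart of Bałaban's, NO Jacobian; `hchart`, `hac_out`, `k < K`, the step weights' support clause and the GRAPH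
integrability are DISPLAYED; nothing of Bałaban asserted; (B4)∕(S-α)∕(O3′) NOT closed; N11 NOT discharged; N08 untouched; K1⁷∕K1⁸∕K1⁹ NOT closed, no registered stub touched; counts
unmoved (typed 28∕28 · discharged 5∕27 · A 5∕28).  One finite `𝕋⁴_{L^K}` programme at fixed `ε = L^{−K}`; R4 closes only the conditional finite-𝕋⁴ rung `BalabanLadder.UV` — NOT ℝ⁴,
NOT OS, NOT a mass gap, NOT Clay.  No `sorry`, `axiom`, `def`, `instance`, `notation`.  Sources (SHAPE only): [I] (0.4) p.253; [III] (2.18) p.257, (2.21) p.258, (3.1) p.264,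
(3.2)–(3.5) p.265, (3.10)–(3.11) p.266, p.267 L18–24, (3.24)–(3.25) p.270.
-/

noncomputable section
open MeasureTheory ProbabilityTheory
open scoped ENNReal NNReal

namespace Summit.QuantumFields.YangMills.Theorems.BalabanUVNodesN11CondLawInFibreChartIntegrable

open Literature.MathematicalPhysics.QuantumFieldTheory.Balaban1983to89 Literature.MathematicalPhysics.QuantumFieldTheory.Balaban1983to89.T4AveragingDisintegration
open BalabanUVNodesN11CondLawInFibreChart BalabanUVNodesN11CondLawInFibreChartComposition BalabanUVNodesN11CondLawInFibreChartSkewAssembly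

/-! ## §1  Generic: a graph-integrable `V`-dependent integrand has integrable chart readings on `μ`-a.e. fibre -/

section Generic

variable {α β X : Type*} [MeasurableSpace α] [MeasurableSpace β] [MeasurableSpace X] {ν : Measure β} {μ : Measure α} [SFinite μ] {κ : Kernel α X}
  [IsSFiniteKernel κ] {avg : β → α} {Ψ : α × X → β} {J : α × X → ℝ≥0} {𝒮 : Set (α × β)}

omit [SFinite μ] [IsSFiniteKernel κ] in
/-- **THE CHART READING OF A GRAPH-INTEGRABLE INTEGRAND IS INTEGRABLE ON THE CHART MEASURE**: under FILE 1's `hchart`, for jointly measurable `G` with `U ↦ G(Ū, U)` ν-integrable,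
`z ↦ J z · G(z.1, Ψ z)` is `(μ ⊗ₘ κ)`-integrable (its `∫⁻ ‖·‖ₑ` is the joint-law integral of `‖G‖ₑ` over the window, the chart landing in the window wherever `J ≠ 0`).
[cite: Balaban1987RG1, (0.4) p.253; Balaban1988Convergent, (3.1) p.264, p.267 L18–24 (bookkeeping)] -/
theorem integrable_chart_of_integrable_graph (havg : Measurable avg) (hΨ : Measurable Ψ) (hJ : Measurable J) (h𝒮 : MeasurableSet 𝒮)
    (hchart : ((μ ⊗ₘ κ).withDensity (fun z => (J z : ℝ≥0∞))).map (fun z => (z.1, Ψ z)) = (jointLaw ν avg).restrict 𝒮)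
    {G : α × β → ℝ} (hG : Measurable G) (hGi : Integrable (fun U => G (avg U, U)) ν) :
    Integrable (fun z : α × X => (J z : ℝ) * G (z.1, Ψ z)) (μ ⊗ₘ κ) := by
  have hmeas : Measurable fun z : α × X => (J z : ℝ) * G (z.1, Ψ z) :=
    (measurable_coe_nnreal_real.comp hJ).mul (hG.comp (measurable_fst.prodMk hΨ))
  refine ⟨hmeas.aestronglyMeasurable, ?_⟩
  -- the windowed absolute value, a measurable `ℝ≥0∞`-integrand vanishing off `𝒮`
  set G' : α × β → ℝ≥0∞ := fun w => 𝒮.indicator (fun w => ‖G w‖ₑ) w with hG'def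
  have hG'm : Measurable G' := (hG.enorm).indicator h𝒮
  have hG'𝒮 : ∀ w, w ∉ 𝒮 → G' w = 0 := fun w hw => Set.indicator_of_notMem hw _
  -- on the chart measure the chart lands in the window wherever `J ≠ 0`
  have hwin : ∀ᵐ z ∂(μ ⊗ₘ κ), (J z : ℝ≥0∞) ≠ 0 → (z.1, Ψ z) ∈ 𝒮 := by
    have h0 : ((μ ⊗ₘ κ).withDensity (fun z => (J z : ℝ≥0∞))) ((fun z => (z.1, Ψ z)) ⁻¹' 𝒮ᶜ) = 0 := by
      rw [← Measure.map_apply (measurable_fst.prodMk hΨ) h𝒮.compl, hchart, Measure.restrict_apply h𝒮.compl,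
        Set.compl_inter_self, measure_empty]
    have h1 : ∀ᵐ z ∂((μ ⊗ₘ κ).withDensity (fun z => (J z : ℝ≥0∞))), (z.1, Ψ z) ∈ 𝒮 := by
      rw [ae_iff]
      exact h0
    exact (ae_withDensity_iff (by fun_prop)).1 h1
  have hae : (fun z : α × X => ‖(J z : ℝ) * G (z.1, Ψ z)‖ₑ) =ᵐ[μ ⊗ₘ κ] fun z => (J z : ℝ≥0∞) * G' (z.1, Ψ z) := by
    filter_upwards [hwin] with z hz
    rw [enorm_mul, Real.enorm_eq_ofReal (J z).coe_nonneg, ENNReal.ofReal_coe_nnreal]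
    by_cases hJz : (J z : ℝ≥0∞) = 0
    · rw [hJz, zero_mul, zero_mul]
    · simp only [hG'def, Set.indicator_of_mem (hz hJz)]
  -- the chart integral of the windowed absolute value is the joint-law integral, bounded by `∫ |G(Ū,U)| dν < ∞`
  have hGU : Measurable fun U => G (avg U, U) := hG.comp (measurable_graphMap havg)
  calc ∫⁻ z, ‖(J z : ℝ) * G (z.1, Ψ z)‖ₑ ∂(μ ⊗ₘ κ)
      = ∫⁻ z, (J z : ℝ≥0∞) * G' (z.1, Ψ z) ∂(μ ⊗ₘ κ) := lintegral_congr_ae hae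
    _ = ∫⁻ w, G' w ∂(jointLaw ν avg) := (lintegral_jointLaw_eq_lintegral_chart hΨ hJ hchart hG'm hG'𝒮).symm
    _ ≤ ∫⁻ w, ‖G w‖ₑ ∂(jointLaw ν avg) := lintegral_mono fun w => Set.indicator_le_self _ _ w
    _ = ∫⁻ U, ‖G (avg U, U)‖ₑ ∂ν := by rw [jointLaw, lintegral_map hG.enorm (measurable_graphMap havg)]
    _ < ∞ := hGi.2

/-- **★ HENCE INTEGRABLE ON `μ`-a.e. FIBRE** (`Measure.integrable_compProd_iff`): the integrability row of FILE 1 ∕ FILE 2's real faces for a `V`-DEPENDENT integrand read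
on the graph (def-T's (†): `G(V′,U) = w(s′)(U,V′)·χ·T(U)`). [cite: Balaban1988Convergent, (3.1) p.264, (3.2)–(3.5) p.265, p.267 L18–24 (bookkeeping)] -/
theorem ae_integrable_chart_of_integrable_graph (havg : Measurable avg) (hΨ : Measurable Ψ) (hJ : Measurable J) (h𝒮 : MeasurableSet 𝒮)
    (hchart : ((μ ⊗ₘ κ).withDensity (fun z => (J z : ℝ≥0∞))).map (fun z => (z.1, Ψ z)) = (jointLaw ν avg).restrict 𝒮)
    {G : α × β → ℝ} (hG : Measurable G) (hGi : Integrable (fun U => G (avg U, U)) ν) :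
    ∀ᵐ V ∂μ, Integrable (fun x => (J (V, x) : ℝ) * G (V, Ψ (V, x))) (κ V) :=
  ((Measure.integrable_compProd_iff
    ((measurable_coe_nnreal_real.comp hJ).mul (hG.comp (measurable_fst.prodMk hΨ))).aestronglyMeasurable).1
    (integrable_chart_of_integrable_graph havg hΨ hJ h𝒮 hchart hG hGi)).1

end Generic

/-! ## §2  FILE 5's composite chart: the fibre integrability row from graph integrability, and the every-`V` skew transport identity for ONE graph-integrable integrand -/

section Skew

variable {β₁ β₂ α₁ α₂ X : Type*} [MeasurableSpace β₁] [MeasurableSpace β₂] [MeasurableSpace α₁] [MeasurableSpace α₂] [MeasurableSpace X]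
variable [StandardBorelSpace β₁] [Nonempty β₁] [StandardBorelSpace α₂] [Nonempty α₂] [StandardBorelSpace β₂] [Nonempty β₂]
variable {ν₁ : Measure β₁} [IsFiniteMeasure ν₁] {ν₂ : Measure β₂} [IsFiniteMeasure ν₂] {μ₁ : Measure α₁} [SigmaFinite μ₁] {μ₂ : Measure α₂} [IsFiniteMeasure μ₂]
variable {a₁ : β₁ → α₁} {a₂ : β₁ × β₂ → α₂} {κin : Kernel (β₁ × α₂) X} [IsSFiniteKernel κin]
variable {Ψin : (β₁ × α₂) × X → β₂} {Jin : (β₁ × α₂) × X → ℝ≥0} {𝒮in : Set (β₁ × (α₂ × β₂))}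

omit [StandardBorelSpace β₂] [Nonempty β₂] in
/-- **★ FILE 5 §4's FIBRE-INTEGRABILITY ROW FROM GRAPH INTEGRABILITY**: under the data of FILE 5 ★★★, for a jointly measurable graph-integrable `G`, for `(μ_out ⊗ μ_in)`-a.e.
`(v₁, v₂)` with `margDensity ν_out μ_out a₁ v₁ ≠ 0` the chart reading `q ↦ J_in(q) · G((v₁,v₂), (q.1.1, Ψ_in q))` is integrable against `(condLaw ν_out a₁ v₁ ⊗ δ_{v₂}) ⊗ₘ κ_in`
(§1 at the composite chart; FILE 5 §1). [cite: Balaban1988Convergent, (2.21) p.258, (3.1) p.264, (3.10)–(3.11) p.266, p.270 L3–6 (bookkeeping)] -/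
theorem ae_integrable_skew_of_integrable_graph [MeasurableEq β₁] (ha₁ : Measurable a₁) (hac₁ : ν₁.map a₁ ≪ μ₁) (ha₂ : Measurable a₂)
    (hΨin : Measurable Ψin) (hJin : Measurable Jin) (h𝒮in : MeasurableSet 𝒮in)
    (hfib : ∀ᵐ u₁ ∂ν₁, ((μ₂ ⊗ₘ Kernel.comap κin (Prod.mk u₁) measurable_prodMk_left).withDensity
        (fun z => (Jin ((u₁, z.1), z.2) : ℝ≥0∞))).map (fun z => (z.1, Ψin ((u₁, z.1), z.2))) =
      (jointLaw ν₂ (fun u₂ => a₂ (u₁, u₂))).restrict (Prod.mk u₁ ⁻¹' 𝒮in))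
    {G : (α₁ × α₂) × (β₁ × β₂) → ℝ} (hG : Measurable G) (hGi : Integrable (fun U : β₁ × β₂ => G ((a₁ U.1, a₂ U), U)) (ν₁.prod ν₂)) :
    ∀ᵐ V ∂(μ₁.prod μ₂), margDensity ν₁ μ₁ a₁ V.1 ≠ 0 →
      Integrable (fun q : (β₁ × α₂) × X => (Jin q : ℝ) * G (V, (q.1.1, Ψin q))) (((condLaw ν₁ a₁ V.1).map (fun u₁ => (u₁, V.2))) ⊗ₘ κin) := by
  have hchart := chart_skew_of_fibrewise (ν₂ := ν₂) (μ₁ := μ₁) ha₁ hac₁ ha₂ hΨin hJin h𝒮in hfib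
  have havg : Measurable fun u : β₁ × β₂ => (a₁ u.1, a₂ u) := (ha₁.comp measurable_fst).prodMk ha₂
  have hI := ae_integrable_chart_of_integrable_graph (ν := ν₁.prod ν₂) (μ := μ₁.prod μ₂)
    (κ := (Kernel.withDensity (condLaw (ν₁.prod μ₂) (Prod.map a₁ id))
          fun V _ => (margDensity (ν₁.prod μ₂) (μ₁.prod μ₂) (Prod.map a₁ id) V : ℝ≥0∞)) ⊗ₖ Kernel.prodMkLeft (α₁ × α₂) κin)
    (Ψ := fun z : (α₁ × α₂) × ((β₁ × α₂) × X) => (z.2.1.1, Ψin z.2)) (J := fun z : (α₁ × α₂) × ((β₁ × α₂) × X) => Jin z.2)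
    havg (show Measurable (fun z : (α₁ × α₂) × ((β₁ × α₂) × X) => (z.2.1.1, Ψin z.2)) by fun_prop) (hJin.comp measurable_snd)
    (measurableSet_skewWindow (α₁ := α₁) ha₂ h𝒮in) hchart hG hGi
  have hdens := margDensity_prodMap_id_ae_eq (μ₂ := μ₂) ha₁ hac₁
  have hcond := ae_prod_of_ae_map_prodMap_id (μ₂ := μ₂) ha₁ hac₁ (condLaw_prod_map_id_ae_eq (ν₁ := ν₁) (μ₂ := μ₂) ha₁)
  have hdm : Measurable (Function.uncurry fun (V : α₁ × α₂) (_ : β₁ × α₂) => (margDensity (ν₁.prod μ₂) (μ₁.prod μ₂) (Prod.map a₁ id) V : ℝ≥0∞)) :=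
    measurable_margDensity.coe_nnreal_ennreal.comp measurable_fst
  filter_upwards [hI, hdens, hcond] with V hV hVd hVc h0
  rw [Kernel.compProd_apply_eq_compProd_sectR, Kernel.sectR_prodMkLeft, Kernel.withDensity_apply _ hdm, withDensity_const,
    Measure.compProd_smul_left, hVd, hVc h0, integrable_smul_measure (ENNReal.coe_ne_zero.mpr h0) ENNReal.coe_ne_top] at hV
  exact hV

/-- **★★ THE SKEW TRANSPORT IDENTITY FOR ONE GRAPH-INTEGRABLE `V`-DEPENDENT INTEGRAND, NO FIBRE-INTEGRABILITY HYPOTHESIS**: under the data of FILE 5 ★★★, for `G` jointly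
measurable, vanishing off the window (`(U_out, (a_in U, U_in)) ∉ 𝒮_in ⇒ G(V, U) = 0`) and graph-integrable, for `(μ_out ⊗ μ_in)`-a.e. `(v₁, v₂)`:
`kernelTransport (ν_out⊗ν_in) (μ_out⊗μ_in) avg (G (v₁,v₂) ·) (v₁,v₂) = kernelTransport ν_out μ_out a₁ (u₁ ↦ ∫ J_in((u₁,v₂),x)·G((v₁,v₂),(u₁,Ψ_in((u₁,v₂),x))) κ_in((u₁,v₂),dx)) v₁` —
FILE 5 ★★★ with its integrability row DISCHARGED by ★ above where the outside density is non-zero, `0 = 0` where it vanishes. [cite: Balaban1987RG1, (0.4) p.253; Balaban1988Convergent, (2.21) p.258, (3.1) p.264, (3.2)–(3.5) p.265, (3.10)–(3.11) p.266, p.267 L18–24] -/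
theorem ae_kernelTransport_skew_eq_chart_of_integrable_graph [MeasurableEq β₁] (ha₁ : Measurable a₁) (hac₁ : ν₁.map a₁ ≪ μ₁) (ha₂ : Measurable a₂)
    (hac : (ν₁.prod ν₂).map (fun u : β₁ × β₂ => (a₁ u.1, a₂ u)) ≪ μ₁.prod μ₂)
    (hΨin : Measurable Ψin) (hJin : Measurable Jin) (h𝒮in : MeasurableSet 𝒮in)
    (hfib : ∀ᵐ u₁ ∂ν₁, ((μ₂ ⊗ₘ Kernel.comap κin (Prod.mk u₁) measurable_prodMk_left).withDensity
        (fun z => (Jin ((u₁, z.1), z.2) : ℝ≥0∞))).map (fun z => (z.1, Ψin ((u₁, z.1), z.2))) =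
      (jointLaw ν₂ (fun u₂ => a₂ (u₁, u₂))).restrict (Prod.mk u₁ ⁻¹' 𝒮in))
    {G : (α₁ × α₂) × (β₁ × β₂) → ℝ} (hG : Measurable G) (hG𝒮 : ∀ V (U : β₁ × β₂), (U.1, (a₂ U, U.2)) ∉ 𝒮in → G (V, U) = 0)
    (hGi : Integrable (fun U : β₁ × β₂ => G ((a₁ U.1, a₂ U), U)) (ν₁.prod ν₂)) :
    ∀ᵐ V ∂(μ₁.prod μ₂),
      kernelTransport (ν₁.prod ν₂) (μ₁.prod μ₂) (fun u : β₁ × β₂ => (a₁ u.1, a₂ u)) (fun U => G (V, U)) V =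
        kernelTransport ν₁ μ₁ a₁ (fun u₁ => ∫ x, (Jin ((u₁, V.2), x) : ℝ) * G (V, (u₁, Ψin ((u₁, V.2), x))) ∂(κin (u₁, V.2))) V.1 := by
  have hchart := chart_skew_of_fibrewise (ν₂ := ν₂) (μ₁ := μ₁) ha₁ hac₁ ha₂ hΨin hJin h𝒮in hfib
  have havg : Measurable fun u : β₁ × β₂ => (a₁ u.1, a₂ u) := (ha₁.comp measurable_fst).prodMk ha₂
  have hT := ae_forall_kernelTransport_eq_chart (ν := ν₁.prod ν₂) (μ := μ₁.prod μ₂)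
    (κ := (Kernel.withDensity (condLaw (ν₁.prod μ₂) (Prod.map a₁ id))
          fun V _ => (margDensity (ν₁.prod μ₂) (μ₁.prod μ₂) (Prod.map a₁ id) V : ℝ≥0∞)) ⊗ₖ Kernel.prodMkLeft (α₁ × α₂) κin)
    (Ψ := fun z : (α₁ × α₂) × ((β₁ × α₂) × X) => (z.2.1.1, Ψin z.2)) (J := fun z : (α₁ × α₂) × ((β₁ × α₂) × X) => Jin z.2)
    havg hac (show Measurable (fun z : (α₁ × α₂) × ((β₁ × α₂) × X) => (z.2.1.1, Ψin z.2)) by fun_prop) (hJin.comp measurable_snd)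
    (measurableSet_skewWindow (α₁ := α₁) ha₂ h𝒮in) hchart
  have h4 := ae_forall_kernelTransport_skew_eq_chart (ν₂ := ν₂) (μ₁ := μ₁) ha₁ hac₁ ha₂ hac hΨin hJin h𝒮in hfib
  have hI := ae_integrable_skew_of_integrable_graph (ν₂ := ν₂) (μ₁ := μ₁) ha₁ hac₁ ha₂ hΨin hJin h𝒮in hfib hG hGi
  have hdens := margDensity_prodMap_id_ae_eq (μ₂ := μ₂) ha₁ hac₁
  have hdm : Measurable (Function.uncurry fun (V : α₁ × α₂) (_ : β₁ × α₂) => (margDensity (ν₁.prod μ₂) (μ₁.prod μ₂) (Prod.map a₁ id) V : ℝ≥0∞)) :=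
    measurable_margDensity.coe_nnreal_ennreal.comp measurable_fst
  filter_upwards [hT, h4, hI, hdens] with V hV hV4 hVI hVd
  have hGV : Measurable fun U => G (V, U) := hG.comp measurable_prodMk_left
  by_cases h0 : margDensity ν₁ μ₁ a₁ V.1 = 0
  · -- the outside density vanishes: both sides are `0`
    rw [hV (fun U => G (V, U)) hGV (fun U hU => hG𝒮 V U hU), Kernel.compProd_apply_eq_compProd_sectR, Kernel.sectR_prodMkLeft,
      Kernel.withDensity_apply _ hdm, withDensity_const, Measure.compProd_smul_left, hVd, h0, ENNReal.coe_zero, zero_smul, integral_zero_measure]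
    unfold kernelTransport
    rw [h0, NNReal.coe_zero, zero_mul]
  · exact hV4 (fun U => G (V, U)) hGV (fun U hU => hG𝒮 V U hU) (hVI h0)

end Skew

/-! ## §3  AT THE RECORD (FILE 6's glue chart): the fibre-integrability rows from graph integrability; def-T's (†) for ALL `s′`, separated, NO fibre-integrability hypothesis -/

section Record

open Node00 hiding SU
open T4Continuum
open BalabanUVNodesN11CondLawInFibreChartAtRecord BalabanUVNodesN11TStepInFibreChart

variable {F : T4Family} {N : ℕ} [NeZero N]

/-- **★ THE FIBRE-INTEGRABILITY ROW AT THE RECORD FROM GRAPH INTEGRABILITY**, keyed on FILE 1's `hchart` AT THE RECORD for the glue-transported composite kernel (FILE 6 ★★★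
`chart_avOfRecord_of_fibrewise_glue` is one producer; an inner-step `hchartf` through FILE 3 is another): for a jointly measurable `G` on `(coarse × fine)` whose graph restriction
`U ↦ G(Ū, U)` is `dU`-integrable, for `dV′`-a.e. `V′` with non-zero outside density at `o = (e_α⁻¹V′).1` the inside reading `q ↦ J(q) · G(V′, e_β(q.1.1, Ψ_in q))` is integrable against
`(condLaw(Π_{sV} Haar, avgRestrOfRecord)(o) ⊗ δ_r) ⊗ₘ κ_in` (§1 at the record chart; FILE 5 §1 transported along `e_α`). [cite: Balaban1988Convergent, (2.21) p.258, (3.1) p.264, (3.10)–(3.11) p.266, p.270 L3–6] -/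
theorem ae_integrable_glue_of_integrable_graph (K j : ℕ) [DecidableEq (PBond (F.P K) j)] [DecidableEq (PBond (F.P K) (j + 1))] (hk : j < K)
    (sV : Finset (PBond (F.P K) j)) (sV' : Finset (PBond (F.P K) (j + 1)))
    (hac_out : (Measure.pi fun _ : ↥sV => (HaarData.haar : Measure (SU N))).map (avgRestrOfRecord F N K j sV sV') ≪
      Measure.pi fun _ : ↥sV' => (HaarData.haar : Measure (SU N)))
    {X : Type*} [MeasurableSpace X]
    {κin : Kernel ((↥sV → SU N) × ({c : PBond (F.P K) (j + 1) // c ∉ sV'} → SU N)) X} [IsSFiniteKernel κin]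
    {Ψin : ((↥sV → SU N) × ({c : PBond (F.P K) (j + 1) // c ∉ sV'} → SU N)) × X → ({b : PBond (F.P K) j // b ∉ sV} → SU N)}
    {Jin : ((↥sV → SU N) × ({c : PBond (F.P K) (j + 1) // c ∉ sV'} → SU N)) × X → ℝ≥0}
    (hΨin : Measurable Ψin) (hJin : Measurable Jin)
    {𝒮 : Set (GaugeField (F.P K) (j + 1) (SU N) × GaugeField (F.P K) j (SU N))} (h𝒮 : MeasurableSet 𝒮)
    (hchart : (((fieldMeasure (F.P K) (j + 1) (SU N)) ⊗ₘ
        (Kernel.comap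
          ((Kernel.withDensity
              (condLaw ((Measure.pi fun _ : ↥sV => (HaarData.haar : Measure (SU N))).prod
                (Measure.pi fun _ : {c : PBond (F.P K) (j + 1) // c ∉ sV'} => (HaarData.haar : Measure (SU N))))
                (Prod.map (avgRestrOfRecord F N K j sV sV') id))
              fun v _ => (margDensity ((Measure.pi fun _ : ↥sV => (HaarData.haar : Measure (SU N))).prod
                  (Measure.pi fun _ : {c : PBond (F.P K) (j + 1) // c ∉ sV'} => (HaarData.haar : Measure (SU N))))
                ((Measure.pi fun _ : ↥sV' => (HaarData.haar : Measure (SU N))).prod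
                  (Measure.pi fun _ : {c : PBond (F.P K) (j + 1) // c ∉ sV'} => (HaarData.haar : Measure (SU N))))
                (Prod.map (avgRestrOfRecord F N K j sV sV') id) v : ℝ≥0∞)) ⊗ₖ
            Kernel.prodMkLeft ((↥sV' → SU N) × ({c : PBond (F.P K) (j + 1) // c ∉ sV'} → SU N)) κin)
          (MeasurableEquiv.piEquivPiSubtypeProd (fun _ : PBond (F.P K) (j + 1) => SU N) (· ∈ sV'))
          (MeasurableEquiv.piEquivPiSubtypeProd (fun _ : PBond (F.P K) (j + 1) => SU N) (· ∈ sV')).measurable)).withDensity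
        (fun z => (Jin z.2 : ℝ≥0∞))).map
        (fun z => (z.1, (MeasurableEquiv.piEquivPiSubtypeProd (fun _ : PBond (F.P K) j => SU N) (· ∈ sV)).symm (z.2.1.1, Ψin z.2))) =
      (jointLaw (fieldMeasure (F.P K) j (SU N)) (avOfRecord F N K j).avg).restrict 𝒮)
    {G : GaugeField (F.P K) (j + 1) (SU N) × GaugeField (F.P K) j (SU N) → ℝ} (hG : Measurable G)
    (hGi : Integrable (fun U => G ((avOfRecord F N K j).avg U, U)) (fieldMeasure (F.P K) j (SU N))) :
    ∀ᵐ V' ∂(fieldMeasure (F.P K) (j + 1) (SU N)),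
      margDensity (Measure.pi fun _ : ↥sV => (HaarData.haar : Measure (SU N))) (Measure.pi fun _ : ↥sV' => (HaarData.haar : Measure (SU N)))
          (avgRestrOfRecord F N K j sV sV') (MeasurableEquiv.piEquivPiSubtypeProd (fun _ : PBond (F.P K) (j + 1) => SU N) (· ∈ sV') V').1 ≠ 0 →
      Integrable (fun q : ((↥sV → SU N) × ({c : PBond (F.P K) (j + 1) // c ∉ sV'} → SU N)) × X =>
          (Jin q : ℝ) * G (V', (MeasurableEquiv.piEquivPiSubtypeProd (fun _ : PBond (F.P K) j => SU N) (· ∈ sV)).symm (q.1.1, Ψin q)))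
        (((condLaw (Measure.pi fun _ : ↥sV => (HaarData.haar : Measure (SU N))) (avgRestrOfRecord F N K j sV sV')
            (MeasurableEquiv.piEquivPiSubtypeProd (fun _ : PBond (F.P K) (j + 1) => SU N) (· ∈ sV') V').1).map
            (fun u₁ => (u₁, (MeasurableEquiv.piEquivPiSubtypeProd (fun _ : PBond (F.P K) (j + 1) => SU N) (· ∈ sV') V').2))) ⊗ₘ κin) := by
  have hI := ae_integrable_chart_of_integrable_graph (avOfRecord_measurable F N K j)
    (show Measurable (fun z : GaugeField (F.P K) (j + 1) (SU N) × (((↥sV → SU N) × ({c : PBond (F.P K) (j + 1) // c ∉ sV'} → SU N)) × X) =>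
      (MeasurableEquiv.piEquivPiSubtypeProd (fun _ : PBond (F.P K) j => SU N) (· ∈ sV)).symm (z.2.1.1, Ψin z.2)) from
      (MeasurableEquiv.measurable _).comp (((measurable_fst.comp measurable_fst).comp measurable_snd).prodMk (hΨin.comp measurable_snd)))
    (show Measurable (fun z : GaugeField (F.P K) (j + 1) (SU N) × (((↥sV → SU N) × ({c : PBond (F.P K) (j + 1) // c ∉ sV'} → SU N)) × X) =>
      Jin z.2) from hJin.comp measurable_snd) h𝒮 hchart hG hGi
  -- FILE 5 §1 (outer density, outside conditional law) transported along `e_α`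
  have hdc : ∀ᵐ V' ∂(fieldMeasure (F.P K) (j + 1) (SU N)),
      margDensity ((Measure.pi fun _ : ↥sV => (HaarData.haar : Measure (SU N))).prod
            (Measure.pi fun _ : {c : PBond (F.P K) (j + 1) // c ∉ sV'} => (HaarData.haar : Measure (SU N))))
          ((Measure.pi fun _ : ↥sV' => (HaarData.haar : Measure (SU N))).prod
            (Measure.pi fun _ : {c : PBond (F.P K) (j + 1) // c ∉ sV'} => (HaarData.haar : Measure (SU N))))
          (Prod.map (avgRestrOfRecord F N K j sV sV') id) (MeasurableEquiv.piEquivPiSubtypeProd (fun _ : PBond (F.P K) (j + 1) => SU N) (· ∈ sV') V') =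
        margDensity (Measure.pi fun _ : ↥sV => (HaarData.haar : Measure (SU N))) (Measure.pi fun _ : ↥sV' => (HaarData.haar : Measure (SU N)))
          (avgRestrOfRecord F N K j sV sV') (MeasurableEquiv.piEquivPiSubtypeProd (fun _ : PBond (F.P K) (j + 1) => SU N) (· ∈ sV') V').1 ∧
      (margDensity (Measure.pi fun _ : ↥sV => (HaarData.haar : Measure (SU N))) (Measure.pi fun _ : ↥sV' => (HaarData.haar : Measure (SU N)))
          (avgRestrOfRecord F N K j sV sV') (MeasurableEquiv.piEquivPiSubtypeProd (fun _ : PBond (F.P K) (j + 1) => SU N) (· ∈ sV') V').1 ≠ 0 →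
        condLaw ((Measure.pi fun _ : ↥sV => (HaarData.haar : Measure (SU N))).prod
            (Measure.pi fun _ : {c : PBond (F.P K) (j + 1) // c ∉ sV'} => (HaarData.haar : Measure (SU N))))
            (Prod.map (avgRestrOfRecord F N K j sV sV') id) (MeasurableEquiv.piEquivPiSubtypeProd (fun _ : PBond (F.P K) (j + 1) => SU N) (· ∈ sV') V') =
          ((condLaw (Measure.pi fun _ : ↥sV => (HaarData.haar : Measure (SU N))) (avgRestrOfRecord F N K j sV sV')
            (MeasurableEquiv.piEquivPiSubtypeProd (fun _ : PBond (F.P K) (j + 1) => SU N) (· ∈ sV') V').1).map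
            (fun u₁ => (u₁, (MeasurableEquiv.piEquivPiSubtypeProd (fun _ : PBond (F.P K) (j + 1) => SU N) (· ∈ sV') V').2)))) := by
    have hdens := margDensity_prodMap_id_ae_eq (ν₁ := Measure.pi fun _ : ↥sV => (HaarData.haar : Measure (SU N)))
      (μ₂ := Measure.pi fun _ : {c : PBond (F.P K) (j + 1) // c ∉ sV'} => (HaarData.haar : Measure (SU N)))
      (measurable_avgRestrOfRecord (F := F) (N := N) K j sV sV') hac_out
    have hcond := ae_prod_of_ae_map_prodMap_id (μ₂ := Measure.pi fun _ : {c : PBond (F.P K) (j + 1) // c ∉ sV'} => (HaarData.haar : Measure (SU N)))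
      (measurable_avgRestrOfRecord (F := F) (N := N) K j sV sV') hac_out
      (condLaw_prod_map_id_ae_eq (ν₁ := Measure.pi fun _ : ↥sV => (HaarData.haar : Measure (SU N)))
        (μ₂ := Measure.pi fun _ : {c : PBond (F.P K) (j + 1) // c ∉ sV'} => (HaarData.haar : Measure (SU N)))
        (measurable_avgRestrOfRecord (F := F) (N := N) K j sV sV'))
    rw [fieldMeasure_eq_map_piEquivPiSubtypeProd_symm (P := F.P K) (G := SU N) sV']
    refine ((MeasurableEquiv.measurableEmbedding
      (MeasurableEquiv.piEquivPiSubtypeProd (fun _ : PBond (F.P K) (j + 1) => SU N) (· ∈ sV')).symm).ae_map_iff).2 ?_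
    filter_upwards [hdens, hcond] with v hv hv'
    simpa only [MeasurableEquiv.apply_symm_apply] using And.intro hv hv'
  have hdm : Measurable (Function.uncurry fun (V : (↥sV' → SU N) × ({c : PBond (F.P K) (j + 1) // c ∉ sV'} → SU N))
      (_ : (↥sV → SU N) × ({c : PBond (F.P K) (j + 1) // c ∉ sV'} → SU N)) =>
        (margDensity ((Measure.pi fun _ : ↥sV => (HaarData.haar : Measure (SU N))).prod
            (Measure.pi fun _ : {c : PBond (F.P K) (j + 1) // c ∉ sV'} => (HaarData.haar : Measure (SU N))))
          ((Measure.pi fun _ : ↥sV' => (HaarData.haar : Measure (SU N))).prod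
            (Measure.pi fun _ : {c : PBond (F.P K) (j + 1) // c ∉ sV'} => (HaarData.haar : Measure (SU N))))
          (Prod.map (avgRestrOfRecord F N K j sV sV') id) V : ℝ≥0∞)) :=
    measurable_margDensity.coe_nnreal_ennreal.comp measurable_fst
  have _hk := hk
  filter_upwards [hI, hdc] with V' hV hVdc h0
  -- `Kernel.comap_apply` is `rfl`: read the fibre measure at `e_α⁻¹ V′`
  have hV' : Integrable (fun q : ((↥sV → SU N) × ({c : PBond (F.P K) (j + 1) // c ∉ sV'} → SU N)) × X =>
      (Jin q : ℝ) * G (V', (MeasurableEquiv.piEquivPiSubtypeProd (fun _ : PBond (F.P K) j => SU N) (· ∈ sV)).symm (q.1.1, Ψin q)))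
      (((Kernel.withDensity
          (condLaw ((Measure.pi fun _ : ↥sV => (HaarData.haar : Measure (SU N))).prod
            (Measure.pi fun _ : {c : PBond (F.P K) (j + 1) // c ∉ sV'} => (HaarData.haar : Measure (SU N))))
            (Prod.map (avgRestrOfRecord F N K j sV sV') id))
          fun v _ => (margDensity ((Measure.pi fun _ : ↥sV => (HaarData.haar : Measure (SU N))).prod
              (Measure.pi fun _ : {c : PBond (F.P K) (j + 1) // c ∉ sV'} => (HaarData.haar : Measure (SU N))))
            ((Measure.pi fun _ : ↥sV' => (HaarData.haar : Measure (SU N))).prod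
              (Measure.pi fun _ : {c : PBond (F.P K) (j + 1) // c ∉ sV'} => (HaarData.haar : Measure (SU N))))
            (Prod.map (avgRestrOfRecord F N K j sV sV') id) v : ℝ≥0∞)) ⊗ₖ
        Kernel.prodMkLeft ((↥sV' → SU N) × ({c : PBond (F.P K) (j + 1) // c ∉ sV'} → SU N)) κin)
        (MeasurableEquiv.piEquivPiSubtypeProd (fun _ : PBond (F.P K) (j + 1) => SU N) (· ∈ sV') V')) := hV
  rw [Kernel.compProd_apply_eq_compProd_sectR, Kernel.sectR_prodMkLeft, Kernel.withDensity_apply _ hdm, withDensity_const,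
    Measure.compProd_smul_left, hVdc.1, hVdc.2 h0, integrable_smul_measure (ENNReal.coe_ne_zero.mpr h0) ENNReal.coe_ne_top] at hV'
  exact hV'

/-- **★★★ def-T's (†) AT THE RECORD FOR ALL NEW SEQUENCES AT ONCE, SEPARATED, WITH NO FIBRE-INTEGRABILITY HYPOTHESIS**, keyed on FILE 1's `hchart` AT THE RECORD for the
glue-transported composite kernel on ANY measurable window `𝒮` (FILE 6 ★★★ or an inner-step `hchartf` through FILE 3 supply it): with step weights of measurable sections
vanishing off `𝒮`, measurable `χ_k(s)`, `T(s)`, and the GRAPH integrability of the (†) integrands `U ↦ w_k(s′)(U, Ū)·χ_k(init s′)(U)·T(init s′)(U)` against `dU`, for `dV′`-a.e.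
`V′` and EVERY `s′`: `(𝐓e^A)_{k+1}(s′)(V′) = kernelRTOfRecord F N K k sV sV' (u₁ ↦ ∫ κ_in((u₁,r),dx) J_in · (w(s′)(·,V′)·χ_k·T)(e_β(u₁, Ψ_in((u₁,r),x)))) o`, `(o, r) = e_α⁻¹V′` —
FILE 2 ★★ `ae_forall_tstepOfRecord_eq_chart` + FILE 6 ★★ `ae_forall_integral_compositeKernel_eq_glue` where the outside density is non-zero (row from ★ above), `0 = 0` where it
vanishes; `ae_all_iff` over the FINITE `SeqOfRecord`. [cite: Balaban1988Convergent, (2.18) p.257, (2.21) p.258, (3.1) p.264, (3.2)–(3.5) p.265, p.267 L18–24, (3.24)–(3.25) p.270] -/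
theorem ae_forall_tstepOfRecord_eq_kernelRTOfRecord_glue_of_integrable_graph (p : B12.RunParams) {k : ℕ} [DecidableEq (PBond (F.P p.K) k)]
    [DecidableEq (PBond (F.P p.K) (k + 1))]
    (ν : Stage7Numerics) (M : ℕ) (w : StepWeightsOfRecord F N ν M) (g : ℕ → ℝ) (hk : k < p.K) (T' : SeqOfRecord F ν M g p.K k → Density (F.P p.K) k (SU N))
    (sV : Finset (PBond (F.P p.K) k)) (sV' : Finset (PBond (F.P p.K) (k + 1)))
    (hac_out : (Measure.pi fun _ : ↥sV => (HaarData.haar : Measure (SU N))).map (avgRestrOfRecord F N p.K k sV sV') ≪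
      Measure.pi fun _ : ↥sV' => (HaarData.haar : Measure (SU N)))
    {X : Type*} [MeasurableSpace X]
    {κin : Kernel ((↥sV → SU N) × ({c : PBond (F.P p.K) (k + 1) // c ∉ sV'} → SU N)) X} [IsSFiniteKernel κin]
    {Ψin : ((↥sV → SU N) × ({c : PBond (F.P p.K) (k + 1) // c ∉ sV'} → SU N)) × X → ({b : PBond (F.P p.K) k // b ∉ sV} → SU N)}
    {Jin : ((↥sV → SU N) × ({c : PBond (F.P p.K) (k + 1) // c ∉ sV'} → SU N)) × X → ℝ≥0}
    (hΨin : Measurable Ψin) (hJin : Measurable Jin)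
    {𝒮 : Set (GaugeField (F.P p.K) (k + 1) (SU N) × GaugeField (F.P p.K) k (SU N))} (h𝒮 : MeasurableSet 𝒮)
    (hchart : (((fieldMeasure (F.P p.K) (k + 1) (SU N)) ⊗ₘ
        (Kernel.comap
          ((Kernel.withDensity
              (condLaw ((Measure.pi fun _ : ↥sV => (HaarData.haar : Measure (SU N))).prod
                (Measure.pi fun _ : {c : PBond (F.P p.K) (k + 1) // c ∉ sV'} => (HaarData.haar : Measure (SU N))))
                (Prod.map (avgRestrOfRecord F N p.K k sV sV') id))
              fun v _ => (margDensity ((Measure.pi fun _ : ↥sV => (HaarData.haar : Measure (SU N))).prod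
                  (Measure.pi fun _ : {c : PBond (F.P p.K) (k + 1) // c ∉ sV'} => (HaarData.haar : Measure (SU N))))
                ((Measure.pi fun _ : ↥sV' => (HaarData.haar : Measure (SU N))).prod
                  (Measure.pi fun _ : {c : PBond (F.P p.K) (k + 1) // c ∉ sV'} => (HaarData.haar : Measure (SU N))))
                (Prod.map (avgRestrOfRecord F N p.K k sV sV') id) v : ℝ≥0∞)) ⊗ₖ
            Kernel.prodMkLeft ((↥sV' → SU N) × ({c : PBond (F.P p.K) (k + 1) // c ∉ sV'} → SU N)) κin)
          (MeasurableEquiv.piEquivPiSubtypeProd (fun _ : PBond (F.P p.K) (k + 1) => SU N) (· ∈ sV'))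
          (MeasurableEquiv.piEquivPiSubtypeProd (fun _ : PBond (F.P p.K) (k + 1) => SU N) (· ∈ sV')).measurable)).withDensity
        (fun z => (Jin z.2 : ℝ≥0∞))).map
        (fun z => (z.1, (MeasurableEquiv.piEquivPiSubtypeProd (fun _ : PBond (F.P p.K) k => SU N) (· ∈ sV)).symm (z.2.1.1, Ψin z.2))) =
      (jointLaw (fieldMeasure (F.P p.K) k (SU N)) (avOfRecord F N p.K k).avg).restrict 𝒮)
    (hw : ∀ s' V', Measurable fun U => w p g k s' U V') (hwj : ∀ s', Measurable fun q : GaugeField (F.P p.K) (k + 1) (SU N) × GaugeField (F.P p.K) k (SU N) =>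
      w p g k s' q.2 q.1)
    (hχ : ∀ s, Measurable (chiSeqOfRecord F N ν M g p.K k s)) (hT : ∀ s, Measurable (T' s))
    (hwS : ∀ s' (U : GaugeField (F.P p.K) k (SU N)) V', (V', U) ∉ 𝒮 → w p g k s' U V' = 0)
    (hGi : ∀ s' : SeqOfRecord F ν M g p.K (k + 1),
      Integrable (fun U => w p g k s' U ((avOfRecord F N p.K k).avg U) * (chiSeqOfRecord F N ν M g p.K k s'.init U * T' s'.init U))
        (fieldMeasure (F.P p.K) k (SU N))) :
    ∀ᵐ V' ∂(fieldMeasure (F.P p.K) (k + 1) (SU N)), ∀ s' : SeqOfRecord F ν M g p.K (k + 1),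
      tstepOfRecord F N ν M w p g k T' s' V' =
        kernelRTOfRecord F N p.K k sV sV'
          (fun u₁ => ∫ x, (Jin ((u₁, (MeasurableEquiv.piEquivPiSubtypeProd (fun _ : PBond (F.P p.K) (k + 1) => SU N) (· ∈ sV') V').2), x) : ℝ) *
            (w p g k s' ((MeasurableEquiv.piEquivPiSubtypeProd (fun _ : PBond (F.P p.K) k => SU N) (· ∈ sV)).symm
                (u₁, Ψin ((u₁, (MeasurableEquiv.piEquivPiSubtypeProd (fun _ : PBond (F.P p.K) (k + 1) => SU N) (· ∈ sV') V').2), x))) V' *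
              (chiSeqOfRecord F N ν M g p.K k s'.init ((MeasurableEquiv.piEquivPiSubtypeProd (fun _ : PBond (F.P p.K) k => SU N) (· ∈ sV)).symm
                  (u₁, Ψin ((u₁, (MeasurableEquiv.piEquivPiSubtypeProd (fun _ : PBond (F.P p.K) (k + 1) => SU N) (· ∈ sV') V').2), x))) *
                T' s'.init ((MeasurableEquiv.piEquivPiSubtypeProd (fun _ : PBond (F.P p.K) k => SU N) (· ∈ sV)).symm
                  (u₁, Ψin ((u₁, (MeasurableEquiv.piEquivPiSubtypeProd (fun _ : PBond (F.P p.K) (k + 1) => SU N) (· ∈ sV') V').2), x)))))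
            ∂(κin (u₁, (MeasurableEquiv.piEquivPiSubtypeProd (fun _ : PBond (F.P p.K) (k + 1) => SU N) (· ∈ sV') V').2)))
          (MeasurableEquiv.piEquivPiSubtypeProd (fun _ : PBond (F.P p.K) (k + 1) => SU N) (· ∈ sV') V').1 := by
  -- the rows from graph integrability (★ above), every `s′` at once by finiteness of the (2.18) index
  have hI' := ae_all_iff.2 fun s' : SeqOfRecord F ν M g p.K (k + 1) =>
    ae_integrable_glue_of_integrable_graph (F := F) (N := N) p.K k hk sV sV' hac_out hΨin hJin h𝒮 hchart
      (G := fun q : GaugeField (F.P p.K) (k + 1) (SU N) × GaugeField (F.P p.K) k (SU N) =>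
        w p g k s' q.2 q.1 * (chiSeqOfRecord F N ν M g p.K k s'.init q.2 * T' s'.init q.2))
      ((hwj s').mul (((hχ _).comp measurable_snd).mul ((hT _).comp measurable_snd))) (hGi s')
  -- FILE 2 ★★ (†) in the chart; FILE 6 ★★ the composite fibre measure unfolded
  have hT' := ae_forall_tstepOfRecord_eq_chart ν M w p g hk T'
    (show Measurable (fun z : GaugeField (F.P p.K) (k + 1) (SU N) × (((↥sV → SU N) × ({c : PBond (F.P p.K) (k + 1) // c ∉ sV'} → SU N)) × X) =>
      (MeasurableEquiv.piEquivPiSubtypeProd (fun _ : PBond (F.P p.K) k => SU N) (· ∈ sV)).symm (z.2.1.1, Ψin z.2)) from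
      (MeasurableEquiv.measurable _).comp (((measurable_fst.comp measurable_fst).comp measurable_snd).prodMk (hΨin.comp measurable_snd)))
    (show Measurable (fun z : GaugeField (F.P p.K) (k + 1) (SU N) × (((↥sV → SU N) × ({c : PBond (F.P p.K) (k + 1) // c ∉ sV'} → SU N)) × X) =>
      Jin z.2) from hJin.comp measurable_snd) h𝒮 hchart hw hχ hT hwS
  have hI := ae_forall_integral_compositeKernel_eq_glue (F := F) (N := N) p.K k sV sV' hac_out κin
  have hdens : ∀ᵐ V' ∂(fieldMeasure (F.P p.K) (k + 1) (SU N)),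
      margDensity ((Measure.pi fun _ : ↥sV => (HaarData.haar : Measure (SU N))).prod
            (Measure.pi fun _ : {c : PBond (F.P p.K) (k + 1) // c ∉ sV'} => (HaarData.haar : Measure (SU N))))
          ((Measure.pi fun _ : ↥sV' => (HaarData.haar : Measure (SU N))).prod
            (Measure.pi fun _ : {c : PBond (F.P p.K) (k + 1) // c ∉ sV'} => (HaarData.haar : Measure (SU N))))
          (Prod.map (avgRestrOfRecord F N p.K k sV sV') id) (MeasurableEquiv.piEquivPiSubtypeProd (fun _ : PBond (F.P p.K) (k + 1) => SU N) (· ∈ sV') V') =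
        margDensity (Measure.pi fun _ : ↥sV => (HaarData.haar : Measure (SU N))) (Measure.pi fun _ : ↥sV' => (HaarData.haar : Measure (SU N)))
          (avgRestrOfRecord F N p.K k sV sV') (MeasurableEquiv.piEquivPiSubtypeProd (fun _ : PBond (F.P p.K) (k + 1) => SU N) (· ∈ sV') V').1 := by
    have hd := margDensity_prodMap_id_ae_eq (ν₁ := Measure.pi fun _ : ↥sV => (HaarData.haar : Measure (SU N)))
      (μ₂ := Measure.pi fun _ : {c : PBond (F.P p.K) (k + 1) // c ∉ sV'} => (HaarData.haar : Measure (SU N)))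
      (measurable_avgRestrOfRecord (F := F) (N := N) p.K k sV sV') hac_out
    rw [fieldMeasure_eq_map_piEquivPiSubtypeProd_symm (P := F.P p.K) (G := SU N) sV']
    refine ((MeasurableEquiv.measurableEmbedding
      (MeasurableEquiv.piEquivPiSubtypeProd (fun _ : PBond (F.P p.K) (k + 1) => SU N) (· ∈ sV')).symm).ae_map_iff).2 ?_
    filter_upwards [hd] with v hv
    simpa only [MeasurableEquiv.apply_symm_apply] using hv
  have hdm : Measurable (Function.uncurry fun (V : (↥sV' → SU N) × ({c : PBond (F.P p.K) (k + 1) // c ∉ sV'} → SU N))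
      (_ : (↥sV → SU N) × ({c : PBond (F.P p.K) (k + 1) // c ∉ sV'} → SU N)) =>
        (margDensity ((Measure.pi fun _ : ↥sV => (HaarData.haar : Measure (SU N))).prod
            (Measure.pi fun _ : {c : PBond (F.P p.K) (k + 1) // c ∉ sV'} => (HaarData.haar : Measure (SU N))))
          ((Measure.pi fun _ : ↥sV' => (HaarData.haar : Measure (SU N))).prod
            (Measure.pi fun _ : {c : PBond (F.P p.K) (k + 1) // c ∉ sV'} => (HaarData.haar : Measure (SU N))))
          (Prod.map (avgRestrOfRecord F N p.K k sV sV') id) V : ℝ≥0∞)) :=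
    measurable_margDensity.coe_nnreal_ennreal.comp measurable_fst
  filter_upwards [hI', hT', hI, hdens] with V' hVI hV' hVc hVd s'
  rw [hV' s', Kernel.comap_apply]
  by_cases h0 : margDensity (Measure.pi fun _ : ↥sV => (HaarData.haar : Measure (SU N))) (Measure.pi fun _ : ↥sV' => (HaarData.haar : Measure (SU N)))
      (avgRestrOfRecord F N p.K k sV sV') (MeasurableEquiv.piEquivPiSubtypeProd (fun _ : PBond (F.P p.K) (k + 1) => SU N) (· ∈ sV') V').1 = 0
  · rw [Kernel.compProd_apply_eq_compProd_sectR, Kernel.sectR_prodMkLeft, Kernel.withDensity_apply _ hdm, withDensity_const,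
      Measure.compProd_smul_left, hVd, h0, ENNReal.coe_zero, zero_smul, integral_zero_measure]
    unfold kernelRTOfRecord Tk.kernelRT kernelTransport
    rw [h0, NNReal.coe_zero, zero_mul]
  · rw [hVc _ (hVI s' h0)]
    rfl

end Record

end Summit.QuantumFields.YangMills.Theorems.BalabanUVNodesN11CondLawInFibreChartIntegrable

end
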